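import Mathlib
import Summits.MatrixMultiplication.MatrixMultiplication.Theses.SnSubsetDichotomy
import Summits.MatrixMultiplication.MatrixMultiplication.Theorems.SnSubsetDichotomyJuntaBranchPlanting
import Summits.MatrixMultiplication.MatrixMultiplication.Theorems.SnSubsetDichotomyJuntaBranchPartnersDisjointBoundary

/-!
# `stub_partnersDisjointOnBand` is self-defeating (gadget planting) — crux `JuntaBranch`
(stmt-MatrixMultiplication-8304), line `mover-covering-amgm`

The registered stub `stub_partnersDisjointOnBand` (hypothesis `hstub` below, verbatim) says that in
a Large(`c`) TPP triple `(S,T,U)` of `S_n` with inclusion-saturated partners, at an `ε`-super-neutral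
block `(I → L)` of `S` whose size lies in the band `[2n^{(1-ε)/2}, c√n/(ε ln n + 2)]`, both partners
have pairwise disjoint source supports on `L`.  Its companion file
`SnSubsetDichotomyJuntaBranchPartnersDisjointBoundary.lean` shows the statement is false without
`Large`; this file shows that WITH `Large` it can hold only vacuously.  PLANTING
(`SnSubsetDichotomyJuntaBranchPlanting.lean`): from any TPP triple at level `n` with
`(n!)^{3/2}e^{-c'√n} ≤ |S||T||U|` (`c' < c`) and an `ε`-super-neutral `S`-block `(I → L)`, the
block-diagonal embedding `S_n × S_2 ↪ S_{n+2}` with the gadget `({1}, {1,(0 1)}, {1})` produces a TPP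
triple at level `n + 2` that is Large(`c`) (`large_planting_threshold`), whose `S`-block extended by
the two fresh fixed points is still `ε`-super-neutral (`rpow_base_shift_le`, `neutral_threshold`,
`(n+2)^{(t+2)} = (n+2)(n+1)n^{(t)}`), whose partners can be inclusion-saturated
(`JuntaBranch.exists_partnerSaturated`, companion file), and whose middle set contains `(τ,1)` and `(τ,(0 1))`, which
send the fresh source `0` to the two fresh targets of the block.  Feeding it to `hstub` contradicts
the asserted disjointness.  Hence (`partnersDisjointOnBand_selfDefeating`): the stub implies that for
every `c' < c`, eventually NO such level-`n` configuration exists with `t + 2` in the level-`(n+2)`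
band — the stub's disjointness conclusion never does work (its hypothesis is met at most on the
volume shell `e^{-c√n} ≤ V/(n!)^{3/2} < e^{-c'√n}` and the `O(1)` band edges), the line's AM–GM
payment (`amgmAtom`/`windowGain`) never fires, and the line's real content is band-bump-freeness of
near-threshold TPP triples, a GlobalBranch-type statement for which it has no lever.  Def-free.
-/

set_option linter.dupNamespace false

open Literature.Combinatorics.Additive
open scoped Classical

namespace Summit.MatrixMultiplication.MatrixMultiplication.Theorems.JuntaBranch.Planting

/-! ## The self-defeat theorem -/

/-- **`stub_partnersDisjointOnBand` is self-defeating.** Hypothesis `hstub` is, verbatim, the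
registered signature of the stub `stub_partnersDisjointOnBand` of line `mover-covering-amgm`
(crux `SnSubsetDichotomy.JuntaBranch`, stmt-MatrixMultiplication-8304). Conclusion: for every
`ε, c > 0` and every `c' < c` there is `n₁` such that for `n ≥ n₁` NO TPP triple `(S,T,U)` of `S_n`
with `(n!)^{3/2} e^{-c'√n} ≤ |S||T||U|` has an `ε`-super-neutral block `(I → L)` of `S` of any size
`t` with `t + 2` in the level-`(n+2)` band `[2(n+2)^{(1-ε)/2}, c√(n+2)/(ε ln(n+2) + 2)]`.
Proof: plant the gadget `({1}, {1,(0 1)}, {1})` on two fresh points (block-diagonal embedding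
`S_n × S_2 ↪ S_{n+2}`), saturate the partners, and feed the planted triple at level `n + 2` with the
block extended by the two fresh fixed points to `hstub`: all its hypotheses hold
(`Planting.large_planting_threshold`, `Planting.rpow_base_shift_le`, `Planting.neutral_threshold`,
`JuntaBranch.exists_partnerSaturated`, and `(n+2)^{(t+2)} = (n+2)(n+1)n^{(t)}`), while the planted middle set contains `(τ,1)` and `(τ,(0 1))`,
which send the fresh source `0` to the two distinct fresh targets of the block — contradicting the
disjointness of source supports that `hstub` asserts. So the stub holds at most vacuously. -/
theorem partnersDisjointOnBand_selfDefeating :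
    (∀ ε : ℝ, 0 < ε → ∀ c : ℝ, 0 < c → ∃ n₀ : ℕ, ∀ n ≥ n₀,
      ∀ S T U : Finset (Equiv.Perm (Fin n)), TripleProductProperty S T U →
      (n.factorial : ℝ) ^ ((3 : ℝ) / 2) * Real.exp (-(c * Real.sqrt (n : ℝ))) ≤
        ((S.card * T.card * U.card : ℕ) : ℝ) →
      (∀ g ∉ T, ¬ TripleProductProperty S (insert g T) U) →
      (∀ g ∉ U, ¬ TripleProductProperty S T (insert g U)) →
      ∀ t : ℕ, 2 * (n : ℝ) ^ ((1 - ε) / 2) ≤ (t : ℝ) →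
      (t : ℝ) ≤ c * Real.sqrt (n : ℝ) / (ε * Real.log (n : ℝ) + 2) →
      ∀ I L : Fin t → Fin n, Function.Injective I → Function.Injective L →
      (n : ℝ) ^ ((1 / 2 + ε) * t) * (S.card : ℝ) <
        ((S.filter (fun σ => ∀ k, σ (I k) = L k)).card : ℝ) * (n.descFactorial t : ℝ) →
      (∀ k k' : Fin t, k ≠ k' → ∀ j : Fin n, (∃ τ ∈ T, τ j = L k) → (∃ τ' ∈ T, τ' j = L k') →
          False) ∧
        (∀ k k' : Fin t, k ≠ k' → ∀ j : Fin n, (∃ τ ∈ U, τ j = L k) → (∃ τ' ∈ U, τ' j = L k') →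
          False)) →
    ∀ ε : ℝ, 0 < ε → ∀ c : ℝ, 0 < c → ∀ c' : ℝ, c' < c → ∃ n₁ : ℕ, ∀ n ≥ n₁,
      ∀ S T U : Finset (Equiv.Perm (Fin n)), TripleProductProperty S T U →
      (n.factorial : ℝ) ^ ((3 : ℝ) / 2) * Real.exp (-(c' * Real.sqrt (n : ℝ))) ≤
        ((S.card * T.card * U.card : ℕ) : ℝ) →
      ∀ t : ℕ, 2 * ((n + 2 : ℕ) : ℝ) ^ ((1 - ε) / 2) ≤ ((t + 2 : ℕ) : ℝ) →
      ((t + 2 : ℕ) : ℝ) ≤ c * Real.sqrt ((n + 2 : ℕ) : ℝ) / (ε * Real.log ((n + 2 : ℕ) : ℝ) + 2) →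
      ∀ I L : Fin t → Fin n, Function.Injective I → Function.Injective L →
      ¬ ((n : ℝ) ^ ((1 / 2 + ε) * t) * (S.card : ℝ) <
          ((S.filter (fun σ => ∀ k, σ (I k) = L k)).card : ℝ) * (n.descFactorial t : ℝ)) := by
  intro hstub ε hε c hc c' hc'
  obtain ⟨n₀, hst⟩ := hstub ε hε c hc
  obtain ⟨nL, hnL⟩ := large_planting_threshold hc hc'
  obtain ⟨nS, hnS⟩ := neutral_threshold ε
  refine ⟨max (max n₀ 1) (max nL nS), fun n hn S T U hTPP hLarge t hlo hhi I L hI hL hSN => ?_⟩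
  have hn₀ : n₀ ≤ n := le_of_max_le_left (le_of_max_le_left hn)
  have hn1 : 1 ≤ n := le_of_max_le_right (le_of_max_le_left hn)
  have hnL' : nL ≤ n := le_of_max_le_left (le_of_max_le_right hn)
  have hnS' : nS ≤ n := le_of_max_le_right (le_of_max_le_right hn)
  classical
  -- basic sizes
  have htn : t ≤ n := by simpa using Fintype.card_le_of_injective L hL
  have hV0 : (0 : ℝ) < ((S.card * T.card * U.card : ℕ) : ℝ) := lt_of_lt_of_le (by positivity) hLarge
  have hV0' : 0 < S.card * T.card * U.card := by exact_mod_cast hV0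
  have hTne : T.Nonempty := by
    rw [← Finset.card_pos]
    rcases Nat.eq_zero_or_pos T.card with h0 | h0
    · rw [h0] at hV0'; simp at hV0'
    · exact h0
  -- ε < 1/2 (otherwise no block is ever super-neutral)
  have hε2 : ε < 1 / 2 := by
    by_contra hge
    push Not at hge
    have hn1' : (1 : ℝ) ≤ n := by exact_mod_cast hn1
    have hsub : ((S.filter (fun σ => ∀ k, σ (I k) = L k)).card : ℝ) ≤ (S.card : ℝ) := by
      exact_mod_cast Finset.card_filter_le _ _
    have hD : (n.descFactorial t : ℝ) ≤ (n : ℝ) ^ ((1 / 2 + ε) * (t : ℝ)) := by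
      have h1 : (n.descFactorial t : ℝ) ≤ ((n ^ t : ℕ) : ℝ) := by
        exact_mod_cast Nat.descFactorial_le_pow n t
      have h2 : ((n ^ t : ℕ) : ℝ) = (n : ℝ) ^ ((t : ℕ) : ℝ) := by
        push_cast; rw [Real.rpow_natCast]
      have h3 : (n : ℝ) ^ ((t : ℕ) : ℝ) ≤ (n : ℝ) ^ ((1 / 2 + ε) * (t : ℝ)) := by
        apply Real.rpow_le_rpow_of_exponent_le hn1'
        have ht0 : (0 : ℝ) ≤ t := Nat.cast_nonneg t
        nlinarith
      linarith [h2 ▸ h1]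
    have := mul_le_mul hsub hD (Nat.cast_nonneg _) (Nat.cast_nonneg _)
    linarith [mul_comm ((n : ℝ) ^ ((1 / 2 + ε) * (t : ℝ))) (S.card : ℝ)]
  -- THE PLANTING. Block-diagonal embedding S_n × S_2 ↪ S_{n+2}.
  set f : Equiv.Perm (Fin n) × Equiv.Perm (Fin 2) →* Equiv.Perm (Fin (n + 2)) :=
    (finSumFinEquiv (m := n) (n := 2)).permCongrHom.toMonoidHom.comp
      (Equiv.Perm.sumCongrHom (Fin n) (Fin 2)) with hf
  have hfinj : Function.Injective f := by
    rw [hf, MonoidHom.coe_comp]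
    exact (finSumFinEquiv (m := n) (n := 2)).permCongrHom.injective.comp
      Equiv.Perm.sumCongrHom_injective
  have hf_left : ∀ (σ : Equiv.Perm (Fin n)) (a : Equiv.Perm (Fin 2)) (i : Fin n),
      f (σ, a) (Fin.castAdd 2 i) = Fin.castAdd 2 (σ i) := by
    intro σ a i
    simp [hf]
  have hf_right : ∀ (σ : Equiv.Perm (Fin n)) (a : Equiv.Perm (Fin 2)) (j : Fin 2),
      f (σ, a) (Fin.natAdd n j) = Fin.natAdd n (a j) := by
    intro σ a j
    simp [hf]
  -- the gadget and the planted triple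
  obtain ⟨Sp, hSp⟩ : ∃ Sp : Finset (Equiv.Perm (Fin (n + 2))),
      Sp = (S ×ˢ ({1} : Finset (Equiv.Perm (Fin 2)))).image f := ⟨_, rfl⟩
  obtain ⟨Tp, hTp⟩ : ∃ Tp : Finset (Equiv.Perm (Fin (n + 2))),
      Tp = (T ×ˢ ({1, Equiv.swap 0 1} : Finset (Equiv.Perm (Fin 2)))).image f := ⟨_, rfl⟩
  obtain ⟨Up, hUp⟩ : ∃ Up : Finset (Equiv.Perm (Fin (n + 2))),
      Up = (U ×ˢ ({1} : Finset (Equiv.Perm (Fin 2)))).image f := ⟨_, rfl⟩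
  have hTPPp : TripleProductProperty Sp Tp Up := by
    rw [hSp, hTp, hUp]
    exact tpp_image_of_injective f hfinj (tpp_product hTPP gadget_tpp)
  have hswap : Equiv.swap (0 : Fin 2) 1 ≠ 1 := by decide
  have hBcard : ({1, Equiv.swap 0 1} : Finset (Equiv.Perm (Fin 2))).card = 2 := by
    rw [Finset.card_insert_of_notMem (by simpa using hswap.symm), Finset.card_singleton]
  have hSpcard : Sp.card = S.card := by
    rw [hSp, Finset.card_image_of_injective _ hfinj, Finset.card_product,
      Finset.card_singleton, Nat.mul_one]
  have hTpcard : Tp.card = T.card * 2 := by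
    rw [hTp, Finset.card_image_of_injective _ hfinj, Finset.card_product, hBcard]
  have hUpcard : Up.card = U.card := by
    rw [hUp, Finset.card_image_of_injective _ hfinj, Finset.card_product,
      Finset.card_singleton, Nat.mul_one]
  -- saturate the partners
  obtain ⟨T'', U'', hTT'', hUU'', hTPP'', hsatM, hsatR⟩ :=
    JuntaBranch.exists_partnerSaturated Sp Tp Up hTPPp
  -- LARGE at level n + 2
  have hLarge'' : (((n + 2).factorial : ℕ) : ℝ) ^ ((3 : ℝ) / 2) *
      Real.exp (-(c * Real.sqrt ((n + 2 : ℕ) : ℝ))) ≤ ((Sp.card * T''.card * U''.card : ℕ) : ℝ) := by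
    have h1 := hnL n hnL'
    have h2 : 2 * ((S.card * T.card * U.card : ℕ) : ℝ) = ((Sp.card * Tp.card * Up.card : ℕ) : ℝ) := by
      rw [hSpcard, hTpcard, hUpcard]; push_cast; ring
    have h3 : ((Sp.card * Tp.card * Up.card : ℕ) : ℝ) ≤ ((Sp.card * T''.card * U''.card : ℕ) : ℝ) := by
      exact_mod_cast Nat.mul_le_mul (Nat.mul_le_mul le_rfl (Finset.card_le_card hTT''))
        (Finset.card_le_card hUU'')
    linarith [mul_le_mul_of_nonneg_left hLarge (by norm_num : (0 : ℝ) ≤ 2)]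
  -- the extended block
  set Ip : Fin (t + 2) → Fin (n + 2) := Fin.append (fun k => Fin.castAdd 2 (I k)) (Fin.natAdd n)
    with hIp
  set Lp : Fin (t + 2) → Fin (n + 2) := Fin.append (fun k => Fin.castAdd 2 (L k)) (Fin.natAdd n)
    with hLp
  have happ_inj : ∀ K : Fin t → Fin n, Function.Injective K →
      Function.Injective (Fin.append (fun k => Fin.castAdd 2 (K k)) (Fin.natAdd n)) := by
    intro K hK
    rw [Fin.append_injective_iff]
    refine ⟨(Fin.castAdd_injective n 2).comp hK, Fin.natAdd_injective 2 n, fun i j h => ?_⟩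
    have h1 := congrArg Fin.val h
    simp only [Fin.val_castAdd, Fin.val_natAdd] at h1
    have := (K i).isLt
    omega
  have hIpinj : Function.Injective Ip := happ_inj I hI
  have hLpinj : Function.Injective Lp := happ_inj L hL
  -- the planted block of Sp is the image of the block of S
  have hblock : (Sp.filter (fun σ => ∀ k, σ (Ip k) = Lp k)).card =
      (S.filter (fun σ => ∀ k, σ (I k) = L k)).card := by
    rw [hSp, Finset.filter_image, Finset.card_image_of_injective _ hfinj]
    have hset : (S ×ˢ ({1} : Finset (Equiv.Perm (Fin 2)))).filter (fun p => ∀ k, f p (Ip k) = Lp k) =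
        (S.filter (fun σ => ∀ k, σ (I k) = L k)) ×ˢ ({1} : Finset (Equiv.Perm (Fin 2))) := by
      ext ⟨σ, a⟩
      simp only [Finset.mem_filter, Finset.mem_product, Finset.mem_singleton]
      constructor
      · rintro ⟨⟨hσ, ha⟩, hk⟩
        refine ⟨⟨hσ, fun k => ?_⟩, ha⟩
        have := hk (Fin.castAdd 2 k)
        rw [hIp, hLp, Fin.append_left, Fin.append_left, hf_left] at this
        exact Fin.castAdd_injective _ _ this
      · rintro ⟨⟨hσ, hk⟩, ha⟩
        refine ⟨⟨hσ, ha⟩, fun k => ?_⟩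
        refine Fin.addCases (fun i => ?_) (fun j => ?_) k
        · rw [hIp, hLp, Fin.append_left, Fin.append_left, hf_left, hk i]
        · rw [hIp, hLp, Fin.append_right, Fin.append_right, hf_right, ha, Equiv.Perm.one_apply]
    rw [hset, Finset.card_product, Finset.card_singleton, Nat.mul_one]
  -- SUPER-NEUTRALITY of the extended block at level n + 2
  have hSNp : ((n + 2 : ℕ) : ℝ) ^ ((1 / 2 + ε) * ((t + 2 : ℕ) : ℝ)) * (Sp.card : ℝ) <
      ((Sp.filter (fun σ => ∀ k, σ (Ip k) = Lp k)).card : ℝ) * ((n + 2).descFactorial (t + 2) : ℝ) := by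
    rw [hblock, hSpcard]
    have hnpos : 0 < n := hn1
    have hn0 : (0 : ℝ) < n := by exact_mod_cast hnpos
    -- descFactorial identity
    have hdesc : ((n + 2).descFactorial (t + 2) : ℝ) = ((n : ℝ) + 2) * ((n : ℝ) + 1) * (n.descFactorial t : ℝ) := by
      have : (n + 2).descFactorial (t + 2) = (n + 2) * ((n + 1) * n.descFactorial t) := by
        rw [Nat.succ_descFactorial_succ, Nat.succ_descFactorial_succ]
      rw [this]; push_cast; ring
    -- split the exponent
    have hx0 : 0 ≤ (1 / 2 + ε) * (t : ℝ) := by positivity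
    have hxn : (1 / 2 + ε) * (t : ℝ) ≤ n := by
      have ht' : (t : ℝ) ≤ n := by exact_mod_cast htn
      have ht0 : (0 : ℝ) ≤ t := Nat.cast_nonneg t
      nlinarith
    have hcast : ((n + 2 : ℕ) : ℝ) = (n : ℝ) + 2 := by push_cast; ring
    have hexp : ((n + 2 : ℕ) : ℝ) ^ ((1 / 2 + ε) * ((t + 2 : ℕ) : ℝ)) =
        ((n : ℝ) + 2) ^ ((1 / 2 + ε) * (t : ℝ)) * ((n : ℝ) + 2) ^ (1 + 2 * ε) := by
      rw [hcast, ← Real.rpow_add (by positivity)]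
      congr 1; push_cast; ring
    have hshift := rpow_base_shift_le hnpos hx0 hxn
    have hneu := hnS n hnS' hε2
    have hSI0 : 0 ≤ ((S.filter (fun σ => ∀ k, σ (I k) = L k)).card : ℝ) := Nat.cast_nonneg _
    have hD0 : 0 ≤ (n.descFactorial t : ℝ) := Nat.cast_nonneg _
    have hS0 : 0 ≤ (S.card : ℝ) := Nat.cast_nonneg _
    have hP0 : 0 ≤ ((n : ℝ) + 2) ^ (1 + 2 * ε) := by positivity
    rw [hexp, hdesc]
    calc ((n : ℝ) + 2) ^ ((1 / 2 + ε) * (t : ℝ)) * ((n : ℝ) + 2) ^ (1 + 2 * ε) * (S.card : ℝ)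
        ≤ (Real.exp 2 * (n : ℝ) ^ ((1 / 2 + ε) * (t : ℝ))) * ((n : ℝ) + 2) ^ (1 + 2 * ε) * (S.card : ℝ) := by
          gcongr
      _ = (Real.exp 2 * ((n : ℝ) + 2) ^ (1 + 2 * ε)) * ((n : ℝ) ^ ((1 / 2 + ε) * (t : ℝ)) * (S.card : ℝ)) := by
          ring
      _ < (Real.exp 2 * ((n : ℝ) + 2) ^ (1 + 2 * ε)) *
            (((S.filter (fun σ => ∀ k, σ (I k) = L k)).card : ℝ) * (n.descFactorial t : ℝ)) :=
          mul_lt_mul_of_pos_left hSN (by positivity)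
      _ ≤ (((n : ℝ) + 2) * ((n : ℝ) + 1)) *
            (((S.filter (fun σ => ∀ k, σ (I k) = L k)).card : ℝ) * (n.descFactorial t : ℝ)) :=
          mul_le_mul_of_nonneg_right hneu (mul_nonneg hSI0 hD0)
      _ = ((S.filter (fun σ => ∀ k, σ (I k) = L k)).card : ℝ) *
            (((n : ℝ) + 2) * ((n : ℝ) + 1) * (n.descFactorial t : ℝ)) := by ring
  -- FEED THE STUB at level n + 2
  have hband_lo : 2 * ((n + 2 : ℕ) : ℝ) ^ ((1 - ε) / 2) ≤ ((t + 2 : ℕ) : ℝ) := hlo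
  have hdis := (hst (n + 2) (le_trans hn₀ (Nat.le_add_right n 2)) Sp T'' U'' hTPP'' hLarge''
    hsatM hsatR (t + 2) hband_lo hhi Ip Lp hIpinj hLpinj hSNp).1
  -- two planted middle elements move the fresh source 0 to both fresh targets
  obtain ⟨τ₀, hτ₀⟩ := hTne
  have hm1 : f (τ₀, 1) ∈ T'' := hTT'' (by
    rw [hTp, Finset.mem_image]
    exact ⟨(τ₀, 1), Finset.mem_product.mpr ⟨hτ₀, by simp⟩, rfl⟩)
  have hm2 : f (τ₀, Equiv.swap 0 1) ∈ T'' := hTT'' (by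
    rw [hTp, Finset.mem_image]
    exact ⟨(τ₀, Equiv.swap 0 1), Finset.mem_product.mpr ⟨hτ₀, by simp⟩, rfl⟩)
  have hk : (Fin.natAdd t (0 : Fin 2) : Fin (t + 2)) ≠ Fin.natAdd t (1 : Fin 2) := by
    intro h
    have := Fin.natAdd_injective 2 t h
    exact absurd this (by decide)
  refine hdis (Fin.natAdd t 0) (Fin.natAdd t 1) hk (Fin.natAdd n 0) ⟨f (τ₀, 1), hm1, ?_⟩
    ⟨f (τ₀, Equiv.swap 0 1), hm2, ?_⟩
  · rw [hf_right, hLp, Fin.append_right, Equiv.Perm.one_apply]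
  · rw [hf_right, hLp, Fin.append_right, Equiv.swap_apply_left]

end Summit.MatrixMultiplication.MatrixMultiplication.Theorems.JuntaBranch.Planting
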